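import Literature.MathematicalPhysics.QuantumFieldTheory.Balaban1983to89.InfiniteVolumeSufficientXXIII
import HarnessLib

/-!
# Infinite volume, what would suffice — XXIV: for `SU(N)`, `N ≥ 3`, the single-loop observables in ALL functions of
# the holonomy do not span — products of TWO loops are necessary

Module XXII refuted, for `SU(N)`, `N ≥ 3`, the density of the span of the defining single Wilson loops `Re/Im tr U_ℓ`;
module XXIII refuted it for every FINITE family `φ_i(U_ℓ)` of functions of the holonomy, and recorded as not claimed
the case of an infinite family — all functions `f : SU(N) → ℝ` at once —, observing that single-edge test
configurations cannot decide it (there every class function IS a single-loop function).  This module decides it with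
TWO loaded edges: the obstruction to spanning by single loops is not the choice of functions of the holonomy but the
absence of PRODUCTS of loops through different places.

## Thesis [folklore]

For every `N = n + 3 ≥ 3` and every dimension `d + 2 ≥ 2`, the real linear span of the class `𝒲_all` of ALL
single-loop observables `U ↦ f(U_ℓ)` — `f : SU(N) → ℝ` ARBITRARY, `ℓ` over all based closed nearest-neighbour walks
of `ℤ^{d+2}` — is NOT sup-norm dense in the gauge-invariant continuous bounded cylinder observables
(`not_spansGaugeInvariantCylinders_allSingleLoopObs`, displayed form `…_wilsonLoopObs_all`, `…_of_three_le`; tree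
predicate `SpansGaugeInvariantCylinders`, XIX); hence no sub-class and no indexed family of single-loop observables
spans (`…_of_subset_allSingleLoopObs`, `…_wilsonLoopObs_family` — XXII and XXIII are the cases `f = Re tr` and
`ι` finite).  Quantitatively (`exists_mul_not_approximable_by_allSingleLoopObs`): there are two members
`W₁, W₂ ∈ 𝒲_all` (one-plaquette class observables at two adjacent plaquettes) whose product `W₁ W₂`, a
gauge-invariant continuous bounded cylinder observable, is at sup-distance `> ε > 0` from every element of
`span_ℝ 𝒲_all`, the distance being attained on `139⁴` explicit test configurations.

## Dictionary and proof (all kernel-checked below)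

* PART A — two loaded edges.  At the configuration `U_{a,b}` (`a` on `e₀`, `b` on `e₁ ≠ e₀`, `1` elsewhere;
  `twoEdgeConfig`) with `a, b` COMMUTING and `q`-torsion, every walk holonomy is the monomial
  `a^{walkExpQ q e₀ ℓ} b^{walkExpQ q e₁ ℓ}` (`walkHolonomy_twoEdgeConfig`), so every single-loop function takes there
  the value `f(a^{m₀} b^{m₁})`, `m₀, m₁ < q` depending on the loop only (`wilsonLoopObs_twoEdgeConfig`).
* PART B — the banded `q`-torsion family for general `q`: `K = ⌊(q-4)/5⌋` (`bandQ`), `α = (i, j) ∈ [0,K)²`,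
  `g_α = diag(ζ_q^{a_α}, ζ_q^{b_α}, ζ_q^{c_α}, 1, …, 1) ∈ SU(n+3)` with `a_α = i+1 ∈ [1,K]`, `b_α = K+2+j ∈ [K+2,2K+1]`,
  `c_α = q - a_α - b_α ∈ [2K+3, q)` (`gTor`; `g_α^q = 1`, the family commutes); the continuous class functions
  `D_α(h) = |det(h - ζ^{a_α})|² + |det(h - ζ^{b_α})|²` (`gapQ`, via XXIII's `charDet`) vanish at `g_α` and — the slots
  `{0}, [1,K], [K+2,2K+1], [2K+3,q)` being disjoint — not at `g_{α₀}`, `α₀ ≠ α` (`gapQ_gTor_ne_zero`); the bump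
  `B_{α₀} = Π_{α ≠ α₀} D_α` (`bumpQ`) vanishes on the family exactly off `α₀`.
* PART C — projective reduction (`q` PRIME).  Every word `a^{m₀} b^{m₁}` in commuting `q`-torsion elements is a POWER
  `(a^{r₀} b^{r₁})^λ` of one of the `q + 2` representative words `a⁰b⁰, a⁰b¹, a¹bᵐ (m < q)` (`WordRep`, `repExp`,
  `exists_wordRep_pow`; the inverse of `m₀` in `𝔽_q`): killing `f(a^{r₀} b^{r₁})` for all representatives and ALL
  `f` kills every word (apply the constraint to `f ∘ (·)^λ`).
* PART D — on the pair `(g_α, g_β)` the representative word `r` takes the value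
  `h_t = diag(ζ^{t₁}, ζ^{t₂}, ζ^{2q-t₁-t₂}, 1, …)` with `t = (a_α r₀ + a_β r₁, b_α r₀ + b_β r₁) mod q`
  (`gTor_pow_mul_gTor_pow`, `eltQ`, `Eexp`); the linear constraint map `T : ℝ^{([0,K)²)²} → ℝ^{WordRep × [0,q)²}`,
  `(T v)(r,t) = Σ_{P : Eexp r P = t} v_P` (`conMap`), satisfies the fibre identity
  `Σ_P v_P f(word_r(P)) = Σ_t f(h_t) (T v)(r,t)` for EVERY `f` (`sum_word_eq_sum_fiber`).
* PART E — one-plaquette class observables `U ↦ f(U_{x;ij})` at any site and orientation (`plaqObsAt`: gauge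
  invariant for class functions, four-edge cylinders, continuous, bounded), products of observables (gauge
  invariance, cylinder and boundedness are inherited), and the two test plaquettes: at `U_{a,b}` with `e₀ = (0,0)`,
  `e₁ = (0,1)` the plaquette `∂p(-e₁; 1,0)` reads `a` and `∂p(-e₀; 0,1)` reads `b` (`plaquetteHolonomyZd_cfg2_negE1/0`).
* PART 0′ — the quantitative form of XXIII's criterion: a finitely supported functional `Λ = Σ_P v_P δ_{U_P}` killing
  `𝒲` with `Λ F ≠ 0` puts `F` at sup-distance `≥ |Λ F| / (2(Σ|v_P| + 1))` from `span 𝒲`, attained at a test point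
  (`exists_lt_abs_sub_of_pointFunctional`).
* PART F — the count and the assembly at `q = 701` (prime, `norm_num`), `K = 139`: `T` has
  `(q + 2) q² = 345 454 903 < 373 301 041 = K⁴` rows (`exists_ne_zero_conMap_eq_zero`, Mathlib
  `LinearMap.ker_ne_bot_of_finrank_lt`), so some `v ≠ 0` has `T v = 0`; by PARTS A, C, D its functional on the
  configurations `U_P = U_{g_α, g_β}` (`cfgQ`) kills `𝒲_all` (`pointFunctional_cfgQ_eq_zero`); at `P₀ = (α₀, β₀)` with
  `v_{P₀} ≠ 0` the test observable `F_{P₀} = B_{α₀}(U_{∂p(-e₁;1,0)}) · B_{β₀}(U_{∂p(-e₀;0,1)})` (`testObsQ`, equal to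
  the product of two members of `𝒲_all`, `testObsQ_eq_mul`) has `Λ F_{P₀} = v_{P₀} B_{α₀}(g_{α₀}) B_{β₀}(g_{β₀}) ≠ 0`
  (`pointFunctional_testObsQ`).  XXIII's PART 0 and PART 0′ conclude.

## Not claimed

Nothing dynamical: whether for the Wilson lattice Yang–Mills torus states convergence of the single-loop expectations
(in all class functions) forces convergence of all correlations is untouched — `Λ` is finitely supported, not a state,
and for a gauge-invariant MEASURE the single-loop distributions carry more than the span does.  Nothing about which
PRODUCT classes span (products of two loops are shown necessary, not sufficient; the full product algebra spans by
XIX).  `N = 2` is different (module XXI: the defining single loops span).  No continuum statement; no statement of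
the audited manuscripts is used or assessed.  NOT summit progress; not Clay.

## In print

The textbook account bounds the number of loop FACTORS needed from ABOVE: «any gauge invariant function … can be
expressed as a combination of products of Wilson loops» and, by the Mandelstam identities for `N × N` matrices, «a
product of Wilson loops in terms of expressions involving at most N factors» (Gambini–Pullin 1996 §3.5 and §3.5.3,
held copy, chunks 75 and 88); Wilson loop functions «capture the full gauge-invariant information about the
connection» (Thiemann 2007 §5.1, chunk 254, after Giles 1981), whence density of the generated ALGEBRA (Sengupta 1994
Thm 4, Lévy 2004 Thm 3.1, as recorded in XIX/XXII).  The present module is a LOWER bound for the lattice cylinder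
algebra of `SU(N)`, `N ≥ 3`: one factor never suffices, whatever functions of the holonomy are admitted, and two
adjacent plaquettes already witness it; no printed statement of this form was found (queries in the cell record
§28.4).  For `N = 2` one factor suffices (XXI), matching the `SU(2)` Mandelstam reduction of products to sums.

## Census consequence (cell record `ir/SUFFICIENT.md` §28)

For `SU(N)`, `N ≥ 3`, the dense-class route from single-loop limits `(W-single)` to `(3a)` is closed OUTRIGHT — not
only for the defining representation (XXII) or finitely many characters (XXIII) but for the entire single-loop class.
On the kinematic side the infinite-volume existence statement `(3a)` therefore genuinely requires limits of loop
CORRELATIONS (products of at least two loop factors; the full product class suffices by XIX), i.e. exactly the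
Cauchy-in-`L` estimate for finite Wilson-loop correlations that the census lists as missing.

VERSIONS: v1 (gen 23).
-/

namespace Literature.MathematicalPhysics.QuantumFieldTheory

open Literature.MathematicalPhysics.QuantumLattice
open Literature.Probability.LatticeModels (zdGraph)
open Balaban1983to89.Missing (SpansGaugeInvariantCylinders)

/-! ## PART A — TWO LOADED EDGES: HOLONOMIES OF COMMUTING `q`-TORSION ELEMENTS ARE MONOMIALS `a^{m₀} b^{m₁}` -/

section TwoEdge

variable {d : ℕ} {G : Type*} [Group G]

/-- The two-edge configuration: `a` on `e₀`, `b` on `e₁`, `1` elsewhere. [folklore] -/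
def twoEdgeConfig (e₀ e₁ : ZdEdge d) (a b : G) : LGConfig d G :=
  fun e => if e = e₀ then a else if e = e₁ then b else 1

/-- For commuting `q`-torsion `a, b` (`q > 0`) and `e₀ ≠ e₁` the dart holonomy of the two-edge configuration is
`a ^ dartExpQ q e₀ e * b ^ dartExpQ q e₁ e`. [folklore] -/
theorem dartHolonomy_twoEdgeConfig {e₀ e₁ : ZdEdge d} (h01 : e₀ ≠ e₁) {q : ℕ} (hq : 0 < q) {a b : G}
    (ha : a ^ q = 1) (hb : b ^ q = 1) (e : (zdGraph d).Dart) :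
    dartHolonomy (twoEdgeConfig e₀ e₁ a b) e = a ^ dartExpQ q e₀ e * b ^ dartExpQ q e₁ e := by
  have hainv : a⁻¹ = a ^ (q - 1) :=
    inv_eq_of_mul_eq_one_right (by rw [← pow_succ', Nat.sub_add_cancel hq, ha])
  have hbinv : b⁻¹ = b ^ (q - 1) :=
    inv_eq_of_mul_eq_one_right (by rw [← pow_succ', Nat.sub_add_cancel hq, hb])
  unfold dartHolonomy dartExpQ
  by_cases h0 : (dartStep e).1 = e₀
  · rw [h0]
    cases (dartStep e).2 <;> simp [twoEdgeConfig, h01, hainv]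
  · by_cases h1 : (dartStep e).1 = e₁
    · rw [h1]
      cases (dartStep e).2 <;> simp [twoEdgeConfig, Ne.symm h01, hbinv]
    · cases (dartStep e).2 <;> simp [twoEdgeConfig, h0, h1]

/-- … along a list of darts the holonomy is `a^{Σ₀} b^{Σ₁}` (the factors commute) … [folklore] -/
theorem prod_map_dartHolonomy_twoEdgeConfig {e₀ e₁ : ZdEdge d} (h01 : e₀ ≠ e₁) {q : ℕ} (hq : 0 < q) {a b : G}
    (hab : Commute a b) (ha : a ^ q = 1) (hb : b ^ q = 1) : ∀ l : List ((zdGraph d).Dart),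
      (l.map (dartHolonomy (twoEdgeConfig e₀ e₁ a b))).prod
        = a ^ (l.map (dartExpQ q e₀)).sum * b ^ (l.map (dartExpQ q e₁)).sum
  | [] => by simp
  | e :: l => by
    rw [List.map_cons, List.prod_cons, List.map_cons, List.sum_cons, List.map_cons, List.sum_cons,
      dartHolonomy_twoEdgeConfig h01 hq ha hb, prod_map_dartHolonomy_twoEdgeConfig h01 hq hab ha hb l,
      pow_add, pow_add, mul_assoc, ← mul_assoc (b ^ dartExpQ q e₁ e), ← (hab.pow_pow _ _).eq]
    simp only [mul_assoc]

/-- … and along any walk it is `a ^ walkExpQ q e₀ w * b ^ walkExpQ q e₁ w`. [folklore] -/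
theorem walkHolonomy_twoEdgeConfig {e₀ e₁ : ZdEdge d} (h01 : e₀ ≠ e₁) {q : ℕ} (hq : 0 < q) {a b : G}
    (hab : Commute a b) (ha : a ^ q = 1) (hb : b ^ q = 1) {x y : Fin d → ℤ} (w : (zdGraph d).Walk x y) :
    walkHolonomy (twoEdgeConfig e₀ e₁ a b) w = a ^ walkExpQ q e₀ w * b ^ walkExpQ q e₁ w :=
  prod_map_dartHolonomy_twoEdgeConfig h01 hq hab ha hb w.darts

/-- **Every single-loop function at a commuting `q`-torsion two-edge configuration is a value `f(a^{m₀} b^{m₁})`,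
`m₀, m₁ < q` depending on the loop only.** [folklore] -/
theorem wilsonLoopObs_twoEdgeConfig {e₀ e₁ : ZdEdge d} (h01 : e₀ ≠ e₁) {q : ℕ} (hq : 0 < q) {a b : G}
    (hab : Commute a b) (ha : a ^ q = 1) (hb : b ^ q = 1) (f : G → ℝ) {x : Fin d → ℤ} (w : (zdGraph d).Walk x x) :
    wilsonLoopObs f w (twoEdgeConfig e₀ e₁ a b) = f (a ^ (walkExpQ q e₀ w % q) * b ^ (walkExpQ q e₁ w % q)) := by
  show f (walkHolonomy _ w) = _
  rw [walkHolonomy_twoEdgeConfig h01 hq hab ha hb, ← pow_eq_pow_mod _ ha, ← pow_eq_pow_mod _ hb]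

end TwoEdge

/-! ## PART B — THE BANDED `q`-TORSION FAMILY FOR GENERAL `q`, ITS SEPARATING BUMPS, AND COMMUTATION -/

section BandQ

variable {n q : ℕ}

/-- The band width `K = ⌊(q - 4)/5⌋`, so that `5K + 4 ≤ q`. [folklore] -/
def bandQ (q : ℕ) : ℕ := (q - 4) / 5

/-- The index set `[0,K)²` of the banded family. [folklore] -/
abbrev BIdx (q : ℕ) := Fin (bandQ q) × Fin (bandQ q)

/-- First band exponent `a_α = i + 1 ∈ [1, K]`. [folklore] -/
def eA (q : ℕ) (α : BIdx q) : ℕ := α.1 + 1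
/-- Second band exponent `b_α = K + 2 + j ∈ [K+2, 2K+1]`. [folklore] -/
def eB (q : ℕ) (α : BIdx q) : ℕ := bandQ q + 2 + α.2
/-- Third exponent `c_α = q - a_α - b_α ∈ [q-3K-1, q-K-3] ⊆ [2K+3, q-1]`. [folklore] -/
def eC (q : ℕ) (α : BIdx q) : ℕ := q - (eA q α + eB q α)

/-- The index set is inhabited only if `q ≥ 9`; in particular `q ≠ 0`. [folklore] -/
theorem ne_zero_of_bidx (α : BIdx q) : q ≠ 0 := by
  have h1 : (α.1 : ℕ) < (q - 4) / 5 := α.1.2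
  omega

/-- `0 < q`. [folklore] -/
theorem pos_of_bidx (α : BIdx q) : 0 < q := Nat.pos_of_ne_zero (ne_zero_of_bidx α)

/-- `5K + 4 ≤ q` (when the index set is inhabited). [folklore] -/
theorem five_mul_bandQ_add_four_le (α : BIdx q) : 5 * bandQ q + 4 ≤ q := by
  have h1 : (α.1 : ℕ) < (q - 4) / 5 := α.1.2
  unfold bandQ; omega

/-- `a_α ∈ [1, K]`. [folklore] -/
theorem eA_bounds (α : BIdx q) : 1 ≤ eA q α ∧ eA q α ≤ bandQ q := by
  have h1 : (α.1 : ℕ) < bandQ q := α.1.2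
  unfold eA; omega

/-- `b_α ∈ [K+2, 2K+1]`. [folklore] -/
theorem eB_bounds (α : BIdx q) : bandQ q + 2 ≤ eB q α ∧ eB q α ≤ 2 * bandQ q + 1 := by
  have h2 : (α.2 : ℕ) < bandQ q := α.2.2
  unfold eB; omega

/-- `a_α + b_α + c_α = q`. [folklore] -/
theorem eA_add_eB_add_eC (α : BIdx q) : eA q α + eB q α + eC q α = q := by
  have hA := eA_bounds α; have hB := eB_bounds α; have h5 := five_mul_bandQ_add_four_le α
  unfold eC; omega

/-- `c_α ∈ [2K+3, q)`. [folklore] -/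
theorem eC_bounds (α : BIdx q) : 2 * bandQ q + 3 ≤ eC q α ∧ eC q α < q := by
  have hA := eA_bounds α; have hB := eB_bounds α; have h5 := five_mul_bandQ_add_four_le α
  unfold eC; omega

/-- THE BANDED FAMILY `g_α = diag(ζ_q^{a_α}, ζ_q^{b_α}, ζ_q^{c_α}, 1, …, 1) ∈ SU(n+3)`. [folklore] -/
noncomputable def gTor (n q : ℕ) (α : BIdx q) : Matrix.specialUnitaryGroup (Fin (n + 3)) ℂ :=
  suDiag3 n (rootζ q ^ eA q α) (rootζ q ^ eB q α) (rootζ q ^ eC q α)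
    (norm_rootζ_pow (ne_zero_of_bidx α) _) (norm_rootζ_pow (ne_zero_of_bidx α) _)
    (norm_rootζ_pow (ne_zero_of_bidx α) _)
    (by rw [← pow_add, ← pow_add, eA_add_eB_add_eC, rootζ_pow_self (ne_zero_of_bidx α)])

/-- `g_α ^ q = 1`. [folklore] -/
theorem gTor_pow_q (α : BIdx q) : gTor n q α ^ q = 1 :=
  suDiag3_pow_eq_one _ _ _ _ _ _ _ (rootζ_pow_pow_self (ne_zero_of_bidx α) _)
    (rootζ_pow_pow_self (ne_zero_of_bidx α) _) (rootζ_pow_pow_self (ne_zero_of_bidx α) _)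

/-- The matrix of `g_α`. [folklore] -/
theorem coe_gTor (α : BIdx q) : ((gTor n q α : Matrix.specialUnitaryGroup (Fin (n + 3)) ℂ) :
    Matrix (Fin (n + 3)) (Fin (n + 3)) ℂ)
    = Matrix.diagonal (diagPad3 n (rootζ q ^ eA q α) (rootζ q ^ eB q α) (rootζ q ^ eC q α)) := rfl

/-- The family is commutative (diagonal). [folklore] -/
theorem commute_gTor (α β : BIdx q) : Commute (gTor n q α) (gTor n q β) := by
  rw [commute_iff_eq]
  apply Subtype.ext
  rw [Submonoid.coe_mul, Submonoid.coe_mul, coe_gTor, coe_gTor, Matrix.diagonal_mul_diagonal,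
    Matrix.diagonal_mul_diagonal]
  congr 1
  funext m
  exact mul_comm _ _

/-- `δ_{ζ^{a_α}}(g_α) = 0`. [folklore] -/
theorem charDet_eA_gTor (α : BIdx q) : charDet (n + 3) (rootζ q ^ eA q α) (gTor n q α) = 0 := by
  rw [gTor, charDet_suDiag3]
  exact Finset.prod_eq_zero (Finset.mem_univ 0) (by rw [diagPad3_apply_zero, sub_self])

/-- `δ_{ζ^{b_α}}(g_α) = 0`. [folklore] -/
theorem charDet_eB_gTor (α : BIdx q) : charDet (n + 3) (rootζ q ^ eB q α) (gTor n q α) = 0 := by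
  rw [gTor, charDet_suDiag3]
  exact Finset.prod_eq_zero (Finset.mem_univ 1) (by rw [diagPad3_apply_one, sub_self])

/-- If `ζ_q^x` (`x < q`) is an eigenvalue of `g_{α₀}` then `x ∈ {a_{α₀}, b_{α₀}, c_{α₀}, 0}`. [folklore] -/
theorem exp_cases_of_charDet_gTor_eq_zero (α₀ : BIdx q) {x : ℕ} (hx : x < q)
    (h : charDet (n + 3) (rootζ q ^ x) (gTor n q α₀) = 0) :
    x = eA q α₀ ∨ x = eB q α₀ ∨ x = eC q α₀ ∨ x = 0 := by
  have hq : q ≠ 0 := ne_zero_of_bidx α₀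
  rw [gTor, charDet_suDiag3, Finset.prod_eq_zero_iff] at h
  obtain ⟨m, -, hm⟩ := h
  rw [sub_eq_zero] at hm
  have h5 := five_mul_bandQ_add_four_le α₀
  have hA : eA q α₀ < q := by have := eA_bounds α₀; omega
  have hB : eB q α₀ < q := by have := eB_bounds α₀; omega
  have hC : eC q α₀ < q := (eC_bounds α₀).2
  rcases diagPad3_apply_cases (n := n) (rootζ q ^ eA q α₀) (rootζ q ^ eB q α₀) (rootζ q ^ eC q α₀) m with
    h1 | h1 | h1 | h1 <;> rw [h1] at hm
  · exact Or.inl (rootζ_pow_inj hq hx hA hm.symm)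
  · exact Or.inr (Or.inl (rootζ_pow_inj hq hx hB hm.symm))
  · exact Or.inr (Or.inr (Or.inl (rootζ_pow_inj hq hx hC hm.symm)))
  · refine Or.inr (Or.inr (Or.inr (rootζ_pow_inj hq hx (Nat.pos_of_ne_zero hq) ?_)))
    rw [pow_zero]; exact hm.symm

/-- THE GAP FUNCTION `D_α(h) = |det(h - ζ^{a_α})|² + |det(h - ζ^{b_α})|²`. [folklore] -/
noncomputable def gapQ (n q : ℕ) (α : BIdx q) (h : Matrix.specialUnitaryGroup (Fin (n + 3)) ℂ) : ℝ :=
  Complex.normSq (charDet (n + 3) (rootζ q ^ eA q α) h) + Complex.normSq (charDet (n + 3) (rootζ q ^ eB q α) h)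

/-- `D_α(g_α) = 0`. [folklore] -/
theorem gapQ_self (α : BIdx q) : gapQ n q α (gTor n q α) = 0 := by
  rw [gapQ, charDet_eA_gTor, charDet_eB_gTor, map_zero, add_zero]

/-- **SEPARATION** `D_α(g_{α₀}) ≠ 0` for `α ≠ α₀`: the exponent slots `{0}`, `[1,K]`, `[K+2,2K+1]`, `[2K+3,q)` are
pairwise disjoint (`5K + 4 ≤ q`). [folklore] -/
theorem gapQ_gTor_ne_zero {α α₀ : BIdx q} (hα : α ≠ α₀) : gapQ n q α (gTor n q α₀) ≠ 0 := by
  intro h0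
  rw [gapQ, add_eq_zero_iff_of_nonneg (Complex.normSq_nonneg _) (Complex.normSq_nonneg _),
    Complex.normSq_eq_zero, Complex.normSq_eq_zero] at h0
  have h5 := five_mul_bandQ_add_four_le α₀
  have hAα := eA_bounds α; have hBα := eB_bounds α
  have hA₀ := eA_bounds α₀; have hB₀ := eB_bounds α₀; have hC₀ := eC_bounds α₀
  have hA := exp_cases_of_charDet_gTor_eq_zero α₀ (x := eA q α) (by omega) h0.1
  have hB := exp_cases_of_charDet_gTor_eq_zero α₀ (x := eB q α) (by omega) h0.2
  have e1 : (α.1 : ℕ) = α₀.1 := by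
    rcases hA with hA | hA | hA | hA
    · unfold eA at hA; omega
    all_goals omega
  have e2 : (α.2 : ℕ) = α₀.2 := by
    rcases hB with hB | hB | hB | hB
    · omega
    · unfold eB at hB; omega
    all_goals omega
  exact hα (Prod.ext (Fin.ext e1) (Fin.ext e2))

/-- `D_α` is a class function. [folklore] -/
theorem gapQ_conj (α : BIdx q) (g h : Matrix.specialUnitaryGroup (Fin (n + 3)) ℂ) :
    gapQ n q α (g * h * g⁻¹) = gapQ n q α h := by
  simp only [gapQ, charDet_conj]

/-- `D_α` is continuous. [folklore] -/
theorem continuous_gapQ (α : BIdx q) : Continuous (gapQ n q α) :=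
  (Complex.continuous_normSq.comp (continuous_charDet _)).add
    (Complex.continuous_normSq.comp (continuous_charDet _))

/-- THE BUMP `B_{α₀} = Π_{α ≠ α₀} D_α`. [folklore] -/
noncomputable def bumpQ (n q : ℕ) (α₀ : BIdx q) (h : Matrix.specialUnitaryGroup (Fin (n + 3)) ℂ) : ℝ :=
  ∏ α ∈ Finset.univ.erase α₀, gapQ n q α h

/-- `B_{α₀}(g_α) = 0` for `α ≠ α₀`. [folklore] -/
theorem bumpQ_gTor_of_ne {α α₀ : BIdx q} (hα : α ≠ α₀) : bumpQ n q α₀ (gTor n q α) = 0 :=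
  Finset.prod_eq_zero (Finset.mem_erase.2 ⟨hα, Finset.mem_univ _⟩) (gapQ_self α)

/-- `B_{α₀}(g_{α₀}) ≠ 0`. [folklore] -/
theorem bumpQ_gTor_self_ne_zero (α₀ : BIdx q) : bumpQ n q α₀ (gTor n q α₀) ≠ 0 :=
  Finset.prod_ne_zero_iff.2 fun _ hα => gapQ_gTor_ne_zero (Finset.ne_of_mem_erase hα)

/-- `B_{α₀}` is a class function. [folklore] -/
theorem bumpQ_conj (α₀ : BIdx q) (g h : Matrix.specialUnitaryGroup (Fin (n + 3)) ℂ) :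
    bumpQ n q α₀ (g * h * g⁻¹) = bumpQ n q α₀ h := by
  simp only [bumpQ, gapQ_conj]

/-- `B_{α₀}` is continuous. [folklore] -/
theorem continuous_bumpQ (α₀ : BIdx q) : Continuous (bumpQ n q α₀) :=
  continuous_finsetProd _ fun α _ => continuous_gapQ α

end BandQ

/-! ## PART C — THE PROJECTIVE REDUCTION OF THE WORDS `a^{m₀} b^{m₁}` FOR PRIME `q` -/

section Reduction

/-- The `q + 2` REPRESENTATIVE WORDS: `none ↦ a⁰b⁰`, `some none ↦ a⁰b¹`, `some (some m) ↦ a¹bᵐ`. [folklore] -/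
abbrev WordRep (q : ℕ) := Option (Option (Fin q))

/-- The exponent pair of a representative word. [folklore] -/
def repExp {q : ℕ} : WordRep q → ℕ × ℕ
  | none => (0, 0)
  | some none => (0, 1)
  | some (some m) => (1, m)

/-- There are `q + 2` representative words. [folklore] -/
theorem card_wordRep (q : ℕ) : Fintype.card (WordRep q) = q + 2 := by
  simp [Fintype.card_option]

/-- **PROJECTIVE REDUCTION** (`q` prime): every word `a^{m₀} b^{m₁}` in commuting `q`-torsion elements is a POWER of
one of the `q + 2` representative words — `(m₀, m₁) = λ · (r₀, r₁)` on the projective line over `𝔽_q` (plus the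
origin), and `a^{λr₀} b^{λr₁} = (a^{r₀} b^{r₁})^λ`.  Consequently the constraints "kill every `f(a^{r₀} b^{r₁})`"
for the representatives imply those for all words (apply them to `f ∘ (·)^λ`). [folklore] -/
theorem exists_wordRep_pow {G : Type*} [Group G] {q : ℕ} (hp : q.Prime) (m₀ m₁ : ℕ) :
    ∃ r : WordRep q, ∃ l : ℕ, ∀ a b : G, Commute a b → a ^ q = 1 → b ^ q = 1 →
      a ^ m₀ * b ^ m₁ = (a ^ (repExp r).1 * b ^ (repExp r).2) ^ l := by
  haveI := Fact.mk hp
  have hpow : ∀ {c : G} {m : ℕ}, c ^ q = 1 → (m : ZMod q) = 0 → c ^ m = 1 := by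
    intro c m hc hm
    obtain ⟨k, rfl⟩ := (ZMod.natCast_eq_zero_iff m q).1 hm
    rw [pow_mul, hc, one_pow]
  by_cases h0 : (m₀ : ZMod q) = 0
  · by_cases h1 : (m₁ : ZMod q) = 0
    · refine ⟨none, 0, fun a b _ ha hb => ?_⟩
      rw [hpow ha h0, hpow hb h1, pow_zero, one_mul]
    · refine ⟨some none, m₁ % q, fun a b _ ha hb => ?_⟩
      simp only [repExp, pow_zero, pow_one, one_mul]
      rw [hpow ha h0, one_mul]
      exact pow_eq_pow_mod m₁ hb
  · refine ⟨some (some ⟨((m₁ : ZMod q) * (m₀ : ZMod q)⁻¹).val, ZMod.val_lt _⟩), m₀ % q,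
      fun a b hab ha hb => ?_⟩
    simp only [repExp, pow_one]
    rw [(hab.pow_right _).mul_pow, ← pow_eq_pow_mod m₀ ha, ← pow_mul, pow_eq_pow_mod m₁ hb,
      pow_eq_pow_mod (_ * _) hb]
    congr 2
    rw [← ZMod.natCast_eq_natCast_iff']
    push_cast
    rw [ZMod.natCast_zmod_val, ZMod.natCast_mod, mul_assoc, inv_mul_cancel₀ h0, mul_one]

end Reduction

/-! ## PART D — THE WORDS EVALUATED ON THE BANDED PAIRS, THE CONSTRAINT MAP AND ITS FIBRE DECOMPOSITION -/

section Words

variable {n q : ℕ}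

/-- `q ≠ 0` as soon as `[0,q)²` is inhabited. [folklore] -/
theorem ne_zero_of_fin2 (t : Fin q × Fin q) : q ≠ 0 := by have := t.1.pos; omega

/-- The `q²` possible VALUES of a word on the family: `h_t = diag(ζ^{t₁}, ζ^{t₂}, ζ^{2q - t₁ - t₂}, 1, …)`,
`t ∈ [0,q)²`. [folklore] -/
noncomputable def eltQ (n q : ℕ) (t : Fin q × Fin q) : Matrix.specialUnitaryGroup (Fin (n + 3)) ℂ :=
  suDiag3 n (rootζ q ^ (t.1 : ℕ)) (rootζ q ^ (t.2 : ℕ)) (rootζ q ^ (2 * q - ((t.1 : ℕ) + t.2)))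
    (norm_rootζ_pow (ne_zero_of_fin2 t) _) (norm_rootζ_pow (ne_zero_of_fin2 t) _)
    (norm_rootζ_pow (ne_zero_of_fin2 t) _)
    (by
      have h1 := t.1.2; have h2 := t.2.2
      rw [← pow_add, ← pow_add, show (t.1 : ℕ) + t.2 + (2 * q - ((t.1 : ℕ) + t.2)) = q * 2 by omega, pow_mul,
        rootζ_pow_self (ne_zero_of_fin2 t), one_pow])

/-- The exponent pair (mod `q`) of the word `r` evaluated at the pair `P = (α, β)`:
`(a_α r₀ + a_β r₁, b_α r₀ + b_β r₁) mod q`. [folklore] -/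
def Eexp (q : ℕ) (r : WordRep q) (P : BIdx q × BIdx q) : Fin q × Fin q :=
  (⟨(eA q P.1 * (repExp r).1 + eA q P.2 * (repExp r).2) % q, Nat.mod_lt _ (pos_of_bidx P.1)⟩,
   ⟨(eB q P.1 * (repExp r).1 + eB q P.2 * (repExp r).2) % q, Nat.mod_lt _ (pos_of_bidx P.1)⟩)

/-- Entrywise product of padded diagonal vectors. [folklore] -/
theorem diagPad3_mul (a b c a' b' c' : ℂ) (m : Fin (n + 3)) :
    diagPad3 n a b c m * diagPad3 n a' b' c' m = diagPad3 n (a * a') (b * b') (c * c') m := by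
  unfold diagPad3; split_ifs <;> simp

/-- The third entries match: `ζ^{c_α r₀ + c_β r₁} = ζ^{2q - t₁ - t₂}` with `t = Eexp q r (α, β)`. [folklore] -/
theorem rootζ_pow_eC_word (r : WordRep q) (P : BIdx q × BIdx q) :
    (rootζ q ^ eC q P.1) ^ (repExp r).1 * (rootζ q ^ eC q P.2) ^ (repExp r).2
      = rootζ q ^ (2 * q - (((Eexp q r P).1 : ℕ) + (Eexp q r P).2)) := by
  have hq : q ≠ 0 := ne_zero_of_bidx P.1
  have hζq : rootζ q ^ q = 1 := rootζ_pow_self hq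
  set r₀ := (repExp r).1
  set r₁ := (repExp r).2
  set X := eA q P.1 * r₀ + eA q P.2 * r₁ with hX
  set Y := eB q P.1 * r₀ + eB q P.2 * r₁ with hY
  set Z := eC q P.1 * r₀ + eC q P.2 * r₁ with hZ
  have ht1 : ((Eexp q r P).1 : ℕ) = X % q := rfl
  have ht2 : ((Eexp q r P).2 : ℕ) = Y % q := rfl
  have hXYZ : X + Y + Z = q * (r₀ + r₁) := by
    have h1 := eA_add_eB_add_eC P.1
    have h2 := eA_add_eB_add_eC P.2
    calc X + Y + Z = (eA q P.1 + eB q P.1 + eC q P.1) * r₀ + (eA q P.2 + eB q P.2 + eC q P.2) * r₁ := by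
          rw [hX, hY, hZ]; ring
      _ = q * (r₀ + r₁) := by rw [h1, h2]; ring
  have hlt1 : X % q < q := Nat.mod_lt _ (Nat.pos_of_ne_zero hq)
  have hlt2 : Y % q < q := Nat.mod_lt _ (Nat.pos_of_ne_zero hq)
  have hL : rootζ q ^ X * rootζ q ^ Y * rootζ q ^ Z = 1 := by
    rw [← pow_add, ← pow_add, hXYZ, pow_mul, hζq, one_pow]
  have hR : rootζ q ^ X * rootζ q ^ Y * rootζ q ^ (2 * q - (X % q + Y % q)) = 1 := by
    rw [pow_eq_pow_mod X hζq, pow_eq_pow_mod Y hζq, ← pow_add, ← pow_add,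
      show X % q + Y % q + (2 * q - (X % q + Y % q)) = q * 2 by omega, pow_mul, hζq, one_pow]
  have hne : rootζ q ^ X * rootζ q ^ Y ≠ 0 :=
    mul_ne_zero (pow_ne_zero _ (Complex.exp_ne_zero _)) (pow_ne_zero _ (Complex.exp_ne_zero _))
  rw [← pow_mul, ← pow_mul, ← pow_add, ht1, ht2]
  exact mul_left_cancel₀ hne (hL.trans hR.symm)

/-- **The word `r` at the pair `(α, β)` IS the value `h_{Eexp q r (α,β)}`**: `g_α^{r₀} g_β^{r₁} = h_t`. [folklore] -/
theorem gTor_pow_mul_gTor_pow (r : WordRep q) (P : BIdx q × BIdx q) :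
    gTor n q P.1 ^ (repExp r).1 * gTor n q P.2 ^ (repExp r).2 = eltQ n q (Eexp q r P) := by
  have hq : q ≠ 0 := ne_zero_of_bidx P.1
  have hζq : rootζ q ^ q = 1 := rootζ_pow_self hq
  apply Subtype.ext
  rw [Submonoid.coe_mul, gTor, gTor, coe_suDiag3_pow, coe_suDiag3_pow, Matrix.diagonal_mul_diagonal]
  show _ = Matrix.diagonal (diagPad3 n _ _ _)
  congr 1
  funext m
  rw [diagPad3_mul, rootζ_pow_eC_word r P]
  congr 1
  · rw [← pow_mul, ← pow_mul, ← pow_add, pow_eq_pow_mod _ hζq]; rfl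
  · rw [← pow_mul, ← pow_mul, ← pow_add, pow_eq_pow_mod _ hζq]; rfl

/-- THE CONSTRAINT MAP `T : ℝ^{([0,K)²)²} → ℝ^{WordRep × [0,q)²}`, `(T v)(r, t) = Σ_{P : Eexp r P = t} v_P`: the
`v` in its kernel are the weight vectors whose functional kills `f(word_r)` for every representative word `r` and
EVERY function `f`. [folklore] -/
noncomputable def conMap (q : ℕ) : (BIdx q × BIdx q → ℝ) →ₗ[ℝ] (WordRep q × (Fin q × Fin q) → ℝ) where
  toFun v rt := ∑ P, (if Eexp q rt.1 P = rt.2 then (1 : ℝ) else 0) * v P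
  map_add' v w := by
    funext rt
    simp only [Pi.add_apply, mul_add, Finset.sum_add_distrib]
  map_smul' c v := by
    funext rt
    simp only [Pi.smul_apply, smul_eq_mul, RingHom.id_apply, Finset.mul_sum, mul_left_comm]

/-- `(T v)(r, t) = Σ_P [Eexp r P = t] v_P`. [folklore] -/
theorem conMap_apply (v : BIdx q × BIdx q → ℝ) (rt : WordRep q × (Fin q × Fin q)) :
    conMap q v rt = ∑ P, (if Eexp q rt.1 P = rt.2 then (1 : ℝ) else 0) * v P := rfl

/-- **FIBRE DECOMPOSITION**: for EVERY function `f` and every representative word `r`,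
`Σ_P v_P f(g_{α}^{r₀} g_{β}^{r₁}) = Σ_t f(h_t) · (T v)(r, t)`. [folklore] -/
theorem sum_word_eq_sum_fiber (v : BIdx q × BIdx q → ℝ) (r : WordRep q)
    (f : Matrix.specialUnitaryGroup (Fin (n + 3)) ℂ → ℝ) :
    ∑ P, v P * f (gTor n q P.1 ^ (repExp r).1 * gTor n q P.2 ^ (repExp r).2)
      = ∑ t, f (eltQ n q t) * conMap q v (r, t) := by
  simp only [conMap_apply, gTor_pow_mul_gTor_pow, Finset.mul_sum]
  rw [Finset.sum_comm]
  refine Finset.sum_congr rfl fun P _ => ?_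
  rw [Finset.sum_eq_single (Eexp q r P) (fun t _ ht => by rw [if_neg (Ne.symm ht), zero_mul, mul_zero])
    (fun h => (h (Finset.mem_univ _)).elim), if_pos rfl, one_mul, mul_comm]

end Words

/-! ## PART E — ONE-PLAQUETTE CLASS OBSERVABLES AT ANY SITE, THEIR PRODUCTS, AND THE TWO TEST PLAQUETTES -/

section PlaqAt

variable {d : ℕ} {G : Type*} [Group G]

/-- `U ↦ f(U_{x,ij})`, the plaquette at `x` in the `(i, j)` orientation. [folklore] -/
def plaqObsAt (f : G → ℝ) (x : Fin d → ℤ) (i j : Fin d) (U : LGConfig d G) : ℝ := f (plaquetteHolonomyZd U x i j)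

/-- Gauge invariant for class functions `f`. [folklore] -/
theorem isZdGaugeInvariant_plaqObsAt {f : G → ℝ} (hf : ∀ g h, f (g * h * g⁻¹) = f h) (x : Fin d → ℤ)
    (i j : Fin d) : IsZdGaugeInvariant (plaqObsAt f x i j) := by
  intro g U
  simp only [plaqObsAt, plaquetteHolonomyZd_gaugeTransformZd, hf]

/-- A cylinder on the four plaquette edges. [folklore] -/
theorem isCylinder_plaqObsAt (f : G → ℝ) (x : Fin d → ℤ) (i j : Fin d) :
    IsCylinder (plaqObsAt f x i j) {(x, i), (x + Pi.single i 1, j), (x + Pi.single j 1, i), (x, j)} := by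
  intro U V h
  simp only [plaqObsAt, plaquetteHolonomyZd]
  rw [h (x, i) (by simp), h (x + Pi.single i 1, j) (by simp), h (x + Pi.single j 1, i) (by simp), h (x, j) (by simp)]

/-- Continuous when `f` is. [folklore] -/
theorem continuous_plaqObsAt [TopologicalSpace G] [IsTopologicalGroup G] {f : G → ℝ} (hf : Continuous f)
    (x : Fin d → ℤ) (i j : Fin d) : Continuous (plaqObsAt f x i j) := by
  have h1 : Continuous fun U : LGConfig d G => plaquetteHolonomyZd U x i j := by
    unfold plaquetteHolonomyZd; fun_prop
  exact hf.comp h1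

/-- Bounded when `f` is continuous and `G` compact. [folklore] -/
theorem exists_abs_plaqObsAt_le [TopologicalSpace G] [CompactSpace G] {f : G → ℝ} (hf : Continuous f)
    (x : Fin d → ℤ) (i j : Fin d) : ∃ C, ∀ U : LGConfig d G, |plaqObsAt f x i j U| ≤ C := by
  obtain ⟨C, hC⟩ := (isCompact_range (continuous_abs.comp hf)).bddAbove
  exact ⟨C, fun U => hC ⟨_, rfl⟩⟩

end PlaqAt

section Products

variable {d : ℕ} {G : Type*}

/-- Products of gauge-invariant observables are gauge invariant. [folklore] -/
theorem isZdGaugeInvariant_mul' [Group G] {F₁ F₂ : LGConfig d G → ℝ} (h₁ : IsZdGaugeInvariant F₁)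
    (h₂ : IsZdGaugeInvariant F₂) : IsZdGaugeInvariant (F₁ * F₂) := fun g U => by
  simp only [Pi.mul_apply, h₁ g U, h₂ g U]

/-- Products of cylinders are cylinders (on the union of the supports). [folklore] -/
theorem isCylinder_mul' {F₁ F₂ : LGConfig d G → ℝ} {S₁ S₂ : Finset (ZdEdge d)} (h₁ : IsCylinder F₁ S₁)
    (h₂ : IsCylinder F₂ S₂) : IsCylinder (F₁ * F₂) (S₁ ∪ S₂) := by
  intro U V h
  simp only [Pi.mul_apply]
  rw [h₁ (fun e he => h e (by simp [Finset.mem_coe.1 he])), h₂ (fun e he => h e (by simp [Finset.mem_coe.1 he]))]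

/-- Products of bounded observables are bounded. [folklore] -/
theorem exists_abs_mul_le' {F₁ F₂ : LGConfig d G → ℝ} (h₁ : ∃ C, ∀ U, |F₁ U| ≤ C) (h₂ : ∃ C, ∀ U, |F₂ U| ≤ C) :
    ∃ C, ∀ U, |(F₁ * F₂) U| ≤ C := by
  obtain ⟨C₁, hC₁⟩ := h₁
  obtain ⟨C₂, hC₂⟩ := h₂
  refine ⟨C₁ * C₂, fun U => ?_⟩
  rw [Pi.mul_apply, abs_mul]
  exact mul_le_mul (hC₁ U) (hC₂ U) (abs_nonneg _) ((abs_nonneg _).trans (hC₁ U))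

end Products

section TestPlaquettes

variable {d : ℕ}

/-- The second loaded edge `e₁ = (0, 1)` (origin, direction `1`) of `ℤ^{d+2}`. [folklore] -/
def edge1 (d : ℕ) : ZdEdge (d + 2) := ((0 : Fin (d + 2) → ℤ), (1 : Fin (d + 2)))

/-- `e₀ ≠ e₁`. [folklore] -/
theorem baseEdge_ne_edge1 : baseEdge d ≠ edge1 d := by
  simp [baseEdge, edge1]

/-- THE TEST CONFIGURATIONS `U_{a,b}`: `a` on `e₀ = (0,0)`, `b` on `e₁ = (0,1)`, `1` elsewhere. [folklore] -/
def cfg2 (d n : ℕ) (a b : Matrix.specialUnitaryGroup (Fin (n + 3)) ℂ) :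
    LGConfig (d + 2) (Matrix.specialUnitaryGroup (Fin (n + 3)) ℂ) :=
  twoEdgeConfig (baseEdge d) (edge1 d) a b

/-- `-e₁ + e₀ ≠ 0`. [folklore] -/
theorem negE1_add_e0_ne_zero : (-(Pi.single 1 1) + Pi.single 0 1 : Fin (d + 2) → ℤ) ≠ 0 := fun h => by
  have := congrFun h 1
  simp at this

/-- `-e₀ + e₁ ≠ 0`. [folklore] -/
theorem negE0_add_e1_ne_zero : (-(Pi.single 0 1) + Pi.single 1 1 : Fin (d + 2) → ℤ) ≠ 0 := fun h => by
  have := congrFun h 0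
  simp at this

/-- `-e_i ≠ 0`. [folklore] -/
theorem negE_ne_zero (i : Fin (d + 2)) : (-(Pi.single i 1) : Fin (d + 2) → ℤ) ≠ 0 := fun h => by
  have := congrFun h i
  simp at this

/-- **The plaquette at `-e₁` in the `(1,0)` orientation reads `a`** at `U_{a,b}`. [folklore] -/
theorem plaquetteHolonomyZd_cfg2_negE1 {n : ℕ} (a b : Matrix.specialUnitaryGroup (Fin (n + 3)) ℂ) :
    plaquetteHolonomyZd (cfg2 d n a b) (-(Pi.single 1 1)) 1 0 = a := by
  have h1 : cfg2 d n a b (-(Pi.single 1 1), 1) = 1 := by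
    simp [cfg2, twoEdgeConfig, baseEdge, edge1]
  have h2 : cfg2 d n a b (-(Pi.single 1 1) + Pi.single 1 1, 0) = a := by
    simp [cfg2, twoEdgeConfig, baseEdge]
  have h3 : cfg2 d n a b (-(Pi.single 1 1) + Pi.single 0 1, 1) = 1 := by
    simp [cfg2, twoEdgeConfig, baseEdge, edge1, negE1_add_e0_ne_zero]
  have h4 : cfg2 d n a b (-(Pi.single 1 1), 0) = 1 := by
    simp [cfg2, twoEdgeConfig, baseEdge, edge1]
  rw [plaquetteHolonomyZd, h1, h2, h3, h4, inv_one, one_mul, mul_one, mul_one]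

/-- **The plaquette at `-e₀` in the `(0,1)` orientation reads `b`** at `U_{a,b}`. [folklore] -/
theorem plaquetteHolonomyZd_cfg2_negE0 {n : ℕ} (a b : Matrix.specialUnitaryGroup (Fin (n + 3)) ℂ) :
    plaquetteHolonomyZd (cfg2 d n a b) (-(Pi.single 0 1)) 0 1 = b := by
  have h1 : cfg2 d n a b (-(Pi.single 0 1), 0) = 1 := by
    simp [cfg2, twoEdgeConfig, baseEdge, edge1]
  have h2 : cfg2 d n a b (-(Pi.single 0 1) + Pi.single 0 1, 1) = b := by
    simp [cfg2, twoEdgeConfig, baseEdge, edge1]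
  have h3 : cfg2 d n a b (-(Pi.single 0 1) + Pi.single 1 1, 0) = 1 := by
    simp [cfg2, twoEdgeConfig, baseEdge, edge1, negE0_add_e1_ne_zero]
  have h4 : cfg2 d n a b (-(Pi.single 0 1), 1) = 1 := by
    simp [cfg2, twoEdgeConfig, baseEdge, edge1]
  rw [plaquetteHolonomyZd, h1, h2, h3, h4, inv_one, one_mul, mul_one, mul_one]

end TestPlaquettes

/-! ## PART 0′ — THE QUANTITATIVE FORM OF XXIII'S CRITERION: A UNIFORM DISTANCE FROM THE SPAN -/

section Criterion

variable {d : ℕ} {G : Type*} {P : Type*} [Fintype P]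

/-- **Quantitative criterion.**  If `Λ = Σ_p v_p δ_{U_p}` kills `𝒲` and `Λ(F) ≠ 0` then `F` is at sup-distance at
least `ε = |Λ F| / (2 (Σ|v_p| + 1)) > 0` from EVERY element of `span_ℝ 𝒲`, witnessed at one of the test points.
[folklore] -/
theorem exists_lt_abs_sub_of_pointFunctional {𝒲 : Set (LGConfig d G → ℝ)} (U : P → LGConfig d G) (v : P → ℝ)
    (h𝒲 : ∀ W ∈ 𝒲, pointFunctional U v W = 0) (F : LGConfig d G → ℝ) (hc : pointFunctional U v F ≠ 0) :
    ∃ ε > 0, ∀ W ∈ Submodule.span ℝ 𝒲, ∃ p, ε < |F (U p) - W (U p)| := by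
  set A : ℝ := ∑ p, |v p| with hA
  have hA0 : 0 ≤ A := Finset.sum_nonneg fun p _ => abs_nonneg (v p)
  have hc' : 0 < |pointFunctional U v F| := abs_pos.2 hc
  refine ⟨|pointFunctional U v F| / (2 * (A + 1)), div_pos hc' (by positivity), fun W hW => ?_⟩
  by_contra hfar
  push Not at hfar
  have hΛW : pointFunctional U v W = 0 := pointFunctional_eq_zero_of_mem_span U v h𝒲 hW
  have h1 : pointFunctional U v (F - W) = pointFunctional U v F := by
    rw [pointFunctional_sub, hΛW, sub_zero]
  have h2 : |pointFunctional U v (F - W)| ≤ A * (|pointFunctional U v F| / (2 * (A + 1))) :=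
    abs_pointFunctional_le U v (W := F - W) (ε := |pointFunctional U v F| / (2 * (A + 1))) fun p => by
      rw [Pi.sub_apply]; exact hfar p
  rw [h1] at h2
  have h3 : A * (|pointFunctional U v F| / (2 * (A + 1))) < |pointFunctional U v F| := by
    rw [mul_div_assoc', div_lt_iff₀ (by positivity)]
    nlinarith
  exact absurd (h2.trans_lt h3) (lt_irrefl _)

end Criterion

/-! ## PART F — THE COUNT AT `q = 701`, THE CLASS, THE TEST DATA, AND THE HEADLINE -/

section Headline

variable {d n : ℕ}

/-- The prime `q = 701` (`K = 139`: `(q + 2) q² = 345 454 903 < K⁴ = 373 301 041`). [folklore] -/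
def qXXIV : ℕ := 701

/-- `701` is prime. [folklore] -/
theorem prime_qXXIV : Nat.Prime qXXIV := by norm_num [qXXIV]

/-- `0 < 701`. [folklore] -/
theorem qXXIV_pos : 0 < qXXIV := by norm_num [qXXIV]

/-- **THE COUNT**: `dim ℝ^{WordRep × [0,q)²} = (q+2) q² < K⁴ = dim ℝ^{([0,K)²)²}` at `q = 701`, so the constraint map
has a kernel vector `v ≠ 0`. [folklore] -/
theorem exists_ne_zero_conMap_eq_zero :
    ∃ v : BIdx qXXIV × BIdx qXXIV → ℝ, v ≠ 0 ∧ conMap qXXIV v = 0 := by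
  have hlt : Module.finrank ℝ (WordRep qXXIV × (Fin qXXIV × Fin qXXIV) → ℝ)
      < Module.finrank ℝ (BIdx qXXIV × BIdx qXXIV → ℝ) := by
    rw [Module.finrank_fintype_fun_eq_card, Module.finrank_fintype_fun_eq_card, Fintype.card_prod,
      Fintype.card_prod, Fintype.card_prod, Fintype.card_prod, card_wordRep, Fintype.card_fin, Fintype.card_fin]
    norm_num [bandQ, qXXIV]
  obtain ⟨v, hv, hv0⟩ := Submodule.exists_mem_ne_zero_of_ne_bot
    (LinearMap.ker_ne_bot_of_finrank_lt hlt (f := conMap qXXIV))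
  exact ⟨v, hv0, hv⟩

/-- **THE CLASS `𝒲_all`: ALL single-loop observables `U ↦ f(U_ℓ)`** — `f : SU(n+3) → ℝ` ARBITRARY (every character
of every finite-dimensional representation, real and imaginary parts, every class function, indeed every function
whatsoever), `ℓ` over all based closed nearest-neighbour walks of `ℤ^{d+2}`. [folklore] -/
def allSingleLoopObs (d n : ℕ) :
    Set (LGConfig (d + 2) (Matrix.specialUnitaryGroup (Fin (n + 3)) ℂ) → ℝ) :=
  Set.range (fun p : (Matrix.specialUnitaryGroup (Fin (n + 3)) ℂ → ℝ) ×
    (Σ x : (Fin (d + 2) → ℤ), (zdGraph (d + 2)).Walk x x) => wilsonLoopObs (d := d + 2) p.1 p.2.2)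

/-- Membership in the class, definitionally. [folklore] -/
theorem wilsonLoopObs_mem_allSingleLoopObs (f : Matrix.specialUnitaryGroup (Fin (n + 3)) ℂ → ℝ)
    {x : Fin (d + 2) → ℤ} (ℓ : (zdGraph (d + 2)).Walk x x) :
    wilsonLoopObs (d := d + 2) f ℓ ∈ allSingleLoopObs d n := ⟨(f, ⟨x, ℓ⟩), rfl⟩

/-- THE `K⁴` TEST CONFIGURATIONS `U_P = U_{g_α, g_β}`, `P = (α, β)`. [folklore] -/
noncomputable def cfgQ (d n : ℕ) (P : BIdx qXXIV × BIdx qXXIV) :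
    LGConfig (d + 2) (Matrix.specialUnitaryGroup (Fin (n + 3)) ℂ) :=
  cfg2 d n (gTor n qXXIV P.1) (gTor n qXXIV P.2)

/-- **A kernel vector of the constraint map kills the whole class**: `Σ_P v_P W(U_P) = 0` for every `W ∈ 𝒲_all`
(PART A: `W(U_P) = f(g_α^{m₀} g_β^{m₁})`; PART C: `= (f ∘ (·)^λ)(g_α^{r₀} g_β^{r₁})` for a representative word;
PART D: fibre decomposition and `T v = 0`). [folklore] -/
theorem pointFunctional_cfgQ_eq_zero {v : BIdx qXXIV × BIdx qXXIV → ℝ} (hv : conMap qXXIV v = 0) :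
    ∀ W ∈ allSingleLoopObs d n, pointFunctional (cfgQ d n) v W = 0 := by
  rintro W ⟨⟨f, ℓ⟩, rfl⟩
  obtain ⟨r, l, hred⟩ := exists_wordRep_pow (G := Matrix.specialUnitaryGroup (Fin (n + 3)) ℂ) prime_qXXIV
    (walkExpQ qXXIV (baseEdge d) ℓ.2 % qXXIV) (walkExpQ qXXIV (edge1 d) ℓ.2 % qXXIV)
  simp only [pointFunctional]
  rw [Finset.sum_congr rfl fun P _ => by
    rw [cfgQ, cfg2, wilsonLoopObs_twoEdgeConfig baseEdge_ne_edge1 qXXIV_pos (commute_gTor P.1 P.2)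
      (gTor_pow_q P.1) (gTor_pow_q P.2), hred _ _ (commute_gTor P.1 P.2) (gTor_pow_q P.1) (gTor_pow_q P.2)]]
  rw [sum_word_eq_sum_fiber v r (fun g => f (g ^ l)), hv]
  simp

/-- THE TEST OBSERVABLE `F_{P₀} = B_{α₀}(U_{-e₁;10}) · B_{β₀}(U_{-e₀;01})`, a product of two one-plaquette class
observables. [folklore] -/
noncomputable def testObsQ (d n : ℕ) (P₀ : BIdx qXXIV × BIdx qXXIV) :
    LGConfig (d + 2) (Matrix.specialUnitaryGroup (Fin (n + 3)) ℂ) → ℝ :=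
  plaqObsAt (bumpQ n qXXIV P₀.1) (-(Pi.single 1 1)) 1 0 * plaqObsAt (bumpQ n qXXIV P₀.2) (-(Pi.single 0 1)) 0 1

/-- `F_{P₀}` is a cylinder (on the eight edges of the two plaquettes). [folklore] -/
theorem isCylinder_testObsQ (P₀ : BIdx qXXIV × BIdx qXXIV) :
    ∃ S : Finset (ZdEdge (d + 2)), IsCylinder (testObsQ d n P₀) S :=
  ⟨_, isCylinder_mul' (isCylinder_plaqObsAt _ _ _ _) (isCylinder_plaqObsAt _ _ _ _)⟩

/-- `F_{P₀}` is continuous. [folklore] -/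
theorem continuous_testObsQ (P₀ : BIdx qXXIV × BIdx qXXIV) : Continuous (testObsQ d n P₀) :=
  (continuous_plaqObsAt (continuous_bumpQ _) _ _ _).mul (continuous_plaqObsAt (continuous_bumpQ _) _ _ _)

/-- `F_{P₀}` is bounded. [folklore] -/
theorem exists_abs_testObsQ_le (P₀ : BIdx qXXIV × BIdx qXXIV) : ∃ C, ∀ U, |testObsQ d n P₀ U| ≤ C :=
  exists_abs_mul_le' (exists_abs_plaqObsAt_le (continuous_bumpQ _) _ _ _)
    (exists_abs_plaqObsAt_le (continuous_bumpQ _) _ _ _)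

/-- `F_{P₀}` is gauge invariant. [folklore] -/
theorem isZdGaugeInvariant_testObsQ (P₀ : BIdx qXXIV × BIdx qXXIV) : IsZdGaugeInvariant (testObsQ d n P₀) :=
  isZdGaugeInvariant_mul' (isZdGaugeInvariant_plaqObsAt (fun g h => bumpQ_conj _ g h) _ _ _)
    (isZdGaugeInvariant_plaqObsAt (fun g h => bumpQ_conj _ g h) _ _ _)

/-- **`F_{P₀}` IS A PRODUCT OF TWO MEMBERS OF THE CLASS**: `F_{P₀} = W₁ · W₂` with `W₁ = B_{α₀}(hol ∂p(-e₁;1,0))`,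
`W₂ = B_{β₀}(hol ∂p(-e₀;0,1))` single-loop observables (plaquette loops `rectWalk · · · 1 1`). [folklore] -/
theorem testObsQ_eq_mul (P₀ : BIdx qXXIV × BIdx qXXIV) :
    testObsQ d n P₀ = wilsonLoopObs (d := d + 2) (bumpQ n qXXIV P₀.1) (rectWalk (-(Pi.single 1 1)) 1 0 1 1)
      * wilsonLoopObs (d := d + 2) (bumpQ n qXXIV P₀.2) (rectWalk (-(Pi.single 0 1)) 0 1 1 1) := by
  funext U
  simp only [testObsQ, Pi.mul_apply, plaqObsAt, wilsonLoopObs, walkHolonomy_rectWalk_one_one]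

/-- **The functional on the test observable**: `Λ(F_{P₀}) = v_{P₀} · B_{α₀}(g_{α₀}) · B_{β₀}(g_{β₀})`. [folklore] -/
theorem pointFunctional_testObsQ (v : BIdx qXXIV × BIdx qXXIV → ℝ) (P₀ : BIdx qXXIV × BIdx qXXIV) :
    pointFunctional (cfgQ d n) v (testObsQ d n P₀)
      = v P₀ * (bumpQ n qXXIV P₀.1 (gTor n qXXIV P₀.1) * bumpQ n qXXIV P₀.2 (gTor n qXXIV P₀.2)) := by
  simp only [pointFunctional, testObsQ, cfgQ, Pi.mul_apply, plaqObsAt, plaquetteHolonomyZd_cfg2_negE1,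
    plaquetteHolonomyZd_cfg2_negE0]
  rw [Finset.sum_eq_single P₀ (fun P _ hP => ?_) (fun h => (h (Finset.mem_univ _)).elim)]
  by_cases h1 : P.1 = P₀.1
  · have h2 : P.2 ≠ P₀.2 := fun h2 => hP (Prod.ext h1 h2)
    rw [bumpQ_gTor_of_ne h2, mul_zero, mul_zero]
  · rw [bumpQ_gTor_of_ne h1, zero_mul, mul_zero]

/-- `Λ(F_{P₀}) ≠ 0` when `v_{P₀} ≠ 0`. [folklore] -/
theorem pointFunctional_testObsQ_ne_zero {v : BIdx qXXIV × BIdx qXXIV → ℝ} {P₀ : BIdx qXXIV × BIdx qXXIV}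
    (hP₀ : v P₀ ≠ 0) : pointFunctional (cfgQ d n) v (testObsQ d n P₀) ≠ 0 := by
  rw [pointFunctional_testObsQ]
  exact mul_ne_zero hP₀ (mul_ne_zero (bumpQ_gTor_self_ne_zero _) (bumpQ_gTor_self_ne_zero _))

/-- **HEADLINE — FOR `SU(N)`, `N ≥ 3`, THE SINGLE-LOOP OBSERVABLES IN ALL FUNCTIONS OF THE HOLONOMY DO NOT SPAN.**
The real linear span of `𝒲_all` — ALL observables `U ↦ f(U_ℓ)`, `f : SU(n+3) → ℝ` arbitrary, `ℓ` any based closed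
walk of `ℤ^{d+2}` — is NOT sup-norm dense in the gauge-invariant continuous bounded cylinder observables: modules
XXII (`f = Re tr`) and XXIII (finitely many `f`) were the special cases; here NO restriction on `f` remains, so the
obstruction is not the choice of class functions but the ABSENCE OF PRODUCTS of loops at different places.  Proof =
PART 0 of XXIII at the `K⁴ = 139⁴` two-edge configurations `U_{g_α,g_β}` with a kernel vector of PART D's
constraint map ((q+2)q² = 345 454 903 rows, `q = 701`) and the test observable `F_{P₀}` of PART F. [folklore] -/
theorem not_spansGaugeInvariantCylinders_allSingleLoopObs (d n : ℕ) :
    ¬ SpansGaugeInvariantCylinders (d + 2) (allSingleLoopObs d n) := by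
  obtain ⟨v, hv0, hv⟩ := exists_ne_zero_conMap_eq_zero
  obtain ⟨P₀, hP₀⟩ : ∃ P₀, v P₀ ≠ 0 := Function.ne_iff.1 hv0
  obtain ⟨S, hS⟩ := isCylinder_testObsQ (d := d) (n := n) P₀
  exact not_spansGaugeInvariantCylinders_of_pointFunctional (cfgQ d n) v (pointFunctional_cfgQ_eq_zero hv)
    (testObsQ d n P₀) S hS (continuous_testObsQ P₀) (exists_abs_testObsQ_le P₀) (isZdGaugeInvariant_testObsQ P₀)
    (pointFunctional_testObsQ_ne_zero hP₀)

/-- The headline with the class displayed. [folklore] -/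
theorem not_spansGaugeInvariantCylinders_wilsonLoopObs_all (d n : ℕ) :
    ¬ SpansGaugeInvariantCylinders (d + 2)
      (Set.range (fun p : (Matrix.specialUnitaryGroup (Fin (n + 3)) ℂ → ℝ) ×
          (Σ x : (Fin (d + 2) → ℤ), (zdGraph (d + 2)).Walk x x) => wilsonLoopObs (d := d + 2) p.1 p.2.2)) :=
  not_spansGaugeInvariantCylinders_allSingleLoopObs d n

/-- The same for every `N ≥ 3`. [folklore] -/
theorem not_spansGaugeInvariantCylinders_wilsonLoopObs_all_of_three_le (d : ℕ) {N : ℕ} (hN : 3 ≤ N) :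
    ¬ SpansGaugeInvariantCylinders (d + 2)
      (Set.range (fun p : (Matrix.specialUnitaryGroup (Fin N) ℂ → ℝ) ×
          (Σ x : (Fin (d + 2) → ℤ), (zdGraph (d + 2)).Walk x x) => wilsonLoopObs (d := d + 2) p.1 p.2.2)) := by
  obtain ⟨n, rfl⟩ := Nat.exists_eq_add_of_le' hN
  exact not_spansGaugeInvariantCylinders_wilsonLoopObs_all d n

/-- **Arbitrary (possibly infinite) indexed families**: for every index type `ι` and every `φ : ι → (SU(n+3) → ℝ)`
the single-loop observables `U ↦ φ_i(U_ℓ)` do not span (XXII: `φ = Re tr`; XXIII: `ι` finite). [folklore] -/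
theorem not_spansGaugeInvariantCylinders_wilsonLoopObs_family {ι : Type*}
    (φ : ι → Matrix.specialUnitaryGroup (Fin (n + 3)) ℂ → ℝ) :
    ¬ SpansGaugeInvariantCylinders (d + 2)
      (Set.range (fun p : ι × (Σ x : (Fin (d + 2) → ℤ), (zdGraph (d + 2)).Walk x x) =>
        wilsonLoopObs (d := d + 2) (φ p.1) p.2.2)) := fun h =>
  not_spansGaugeInvariantCylinders_wilsonLoopObs_all d n
    (spansGaugeInvariantCylinders_mono (Submodule.span_mono (by
      rintro W ⟨⟨i, ℓ⟩, rfl⟩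
      exact ⟨(φ i, ℓ), rfl⟩)) h)

/-- **Any sub-class** `𝒲 ⊆ 𝒲_all` of single-loop observables fails to span. [folklore] -/
theorem not_spansGaugeInvariantCylinders_of_subset_allSingleLoopObs
    {𝒲 : Set (LGConfig (d + 2) (Matrix.specialUnitaryGroup (Fin (n + 3)) ℂ) → ℝ)} (h𝒲 : 𝒲 ⊆ allSingleLoopObs d n) :
    ¬ SpansGaugeInvariantCylinders (d + 2) 𝒲 := fun h =>
  not_spansGaugeInvariantCylinders_allSingleLoopObs d n (spansGaugeInvariantCylinders_mono (Submodule.span_mono h𝒲) h)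

/-- **PRODUCTS OF TWO LOOPS ARE NECESSARY — quantitatively.**  There are two members `W₁, W₂ ∈ 𝒲_all` (one-plaquette
class observables at the plaquettes `∂p(-e₁;1,0)` and `∂p(-e₀;0,1)`) whose PRODUCT `W₁ W₂` — a gauge-invariant
continuous bounded cylinder observable — stays at sup-distance `> ε > 0` from every element of `span_ℝ 𝒲_all`, the
distance being witnessed on the finitely many test configurations `U_P`. [folklore] -/
theorem exists_mul_not_approximable_by_allSingleLoopObs (d n : ℕ) :
    ∃ W₁ ∈ allSingleLoopObs d n, ∃ W₂ ∈ allSingleLoopObs d n,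
      (∃ S : Finset (ZdEdge (d + 2)), IsCylinder (W₁ * W₂) S) ∧ Continuous (W₁ * W₂) ∧
      (∃ C, ∀ U, |(W₁ * W₂) U| ≤ C) ∧ IsZdGaugeInvariant (W₁ * W₂) ∧
      ∃ ε > 0, ∀ W ∈ Submodule.span ℝ (allSingleLoopObs d n),
        ∃ P : BIdx qXXIV × BIdx qXXIV, ε < |(W₁ * W₂) (cfgQ d n P) - W (cfgQ d n P)| := by
  obtain ⟨v, hv0, hv⟩ := exists_ne_zero_conMap_eq_zero
  obtain ⟨P₀, hP₀⟩ : ∃ P₀, v P₀ ≠ 0 := Function.ne_iff.1 hv0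
  refine ⟨_, wilsonLoopObs_mem_allSingleLoopObs (bumpQ n qXXIV P₀.1) (rectWalk (-(Pi.single 1 1)) 1 0 1 1),
    _, wilsonLoopObs_mem_allSingleLoopObs (bumpQ n qXXIV P₀.2) (rectWalk (-(Pi.single 0 1)) 0 1 1 1), ?_⟩
  rw [← testObsQ_eq_mul]
  exact ⟨isCylinder_testObsQ P₀, continuous_testObsQ P₀, exists_abs_testObsQ_le P₀, isZdGaugeInvariant_testObsQ P₀,
    exists_lt_abs_sub_of_pointFunctional (cfgQ d n) v (pointFunctional_cfgQ_eq_zero hv) _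
      (pointFunctional_testObsQ_ne_zero hP₀)⟩

end Headline

end Literature.MathematicalPhysics.QuantumFieldTheory
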